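import Literature.Probability.LatticeModels.HitOriginBeforeExit
import HarnessLib

/-!
# The strong Markov decomposition of the killed Green's function at the hitting time of a set,
# and the first-moment hitting bound (Lawler 1991, §1.5 and (2.46)–(2.47))

Topic `Literature/Probability/LatticeModels`; discrete potential theory on `ℤ²` in the vocabulary
of `GreenFunctionConformalRadius.lean` / `EscapeFromOrigin.lean`
(`G_A(x,y) = SRW.killedGreen (ChordalLERW.siteGraph A) x y`; `H_Λ(x,·) = poissonKernel Λ x`, the exit
distribution of the finite set `Λ`). For `B ⊆ A` finite and the walk started at `x ∉ B`, the exit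
distribution of `A ∖ B` restricted to `B` is the hitting distribution of `B` before leaving `A`,
`P^x(τ_B < ξ_A, S_{τ_B} = b) = H_{A∖B}(x, b)`, and:

* `KozdronLawler.killedGreen_eq_sum_hitDist_mul` — **`G_A(x,y) = Σ_{b ∈ B} H_{A∖B}(x,b) G_A(b,y)`**
  for `y ∈ B`, `x ∉ B` (strong Markov property at `τ_B`; here: uniqueness of the discrete Dirichlet
  problem on `A ∖ B` for the function `G_A(·,y)`, harmonic off `y`);
* `KozdronLawler.sum_killedGreen_le_mul_hitProb` — the **first-moment hitting bound**
  `Σ_{y ∈ B} G_A(x,y) ≤ M · P^x(τ_B < ξ_A)` whenever `Σ_{y ∈ B} G_A(b,y) ≤ M` for all `b ∈ B`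
  (`E^x[V] = Σ_b P^x(S_{τ_B} = b) E^b[V] ≤ P^x(τ_B < ξ_A) max_b E^b[V]`, `V` the number of visits to
  `B`; the mechanism of Lawler 1991, (2.46)–(2.47), Lemma 2.3.5, Lemma 2.5.4), with
  `P^x(τ_B < ξ_A) = Σ_{b ∈ B} H_{A∖B}(x,b)`.

These generalise `killedGreen_eq_hitProb_mul` (`B = {0}`). No named fact is introduced.

## References

* G. F. Lawler, *Intersections of Random Walks* (1991), §1.5, §2.3 (2.46)–(2.47) [Lawler1991].
-/

noncomputable section

open Finset
open Literature.Probability.RandomPlanarGeometry (ChordalLERW.siteGraph)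

namespace Literature.Probability.LatticeModels

namespace KozdronLawler

section PlanarSet

variable (A : Finset (Site 2))

/-- `x ↦ G_A(x,y)` is harmonic on `A ∖ {y}` (first-step equation off the pole), `y ∈ A`.
[folklore] -/
theorem latticeLaplacianZd_killedGreen_eq_zero_of_ne {y : Site 2} (hy : y ∈ A) {w : Site 2}
    (hw : w ∈ A) (hwy : w ≠ y) :
    latticeLaplacianZd (fun v => SRW.killedGreen (ChordalLERW.siteGraph (↑A : Set (Site 2))) v y) w = 0 := by
  classical
  rw [latticeLaplacianZd_eq_sum_neighborFinset, Finset.sum_sub_distrib, Finset.sum_const,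
    card_neighborFinset_zdGraph_holds, nsmul_eq_mul]
  have hfs := killedGreen_siteGraph_first_step A hw y
  rw [if_neg hwy, zero_add] at hfs
  have hsum : ∑ v ∈ (zdGraph 2).neighborFinset w,
      (if v ∈ A then SRW.killedGreen (ChordalLERW.siteGraph (↑A : Set (Site 2))) v y else 0) =
      ∑ v ∈ (zdGraph 2).neighborFinset w, SRW.killedGreen (ChordalLERW.siteGraph (↑A : Set (Site 2))) v y := by
    refine Finset.sum_congr rfl fun v _ => ?_
    split_ifs with hv
    · rfl
    · exact (killedGreen_siteGraph_of_not_mem A hv hy).symm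
  rw [hsum] at hfs
  rw [hfs]
  push_cast
  ring

/-- **Strong Markov decomposition at the hitting time of `B`**: for `B ⊆ A` finite, `y ∈ B` and
`x ∉ B`, `G_A(x,y) = Σ_{b ∈ B} H_{A∖B}(x,b) G_A(b,y)`, where `H_{A∖B}(x,b) = poissonKernel (A \ B) x b`
is the probability that the walk from `x` enters `B` at `b` before leaving `A`.
[cite: Lawler1991, §1.5] -/
theorem killedGreen_eq_sum_hitDist_mul {B : Finset (Site 2)} (hBA : B ⊆ A) {y : Site 2} (hy : y ∈ B)
    {x : Site 2} (hxB : x ∉ B) :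
    SRW.killedGreen (ChordalLERW.siteGraph (↑A : Set (Site 2))) x y =
      ∑ b ∈ B, poissonKernel (A \ B) x b * SRW.killedGreen (ChordalLERW.siteGraph (↑A : Set (Site 2))) b y := by
  classical
  have hyA : y ∈ A := hBA hy
  set F : Site 2 → ℝ := fun v => SRW.killedGreen (ChordalLERW.siteGraph (↑A : Set (Site 2))) v y with hF
  by_cases hx : x ∈ A
  · have hx' : x ∈ A \ B := Finset.mem_sdiff.2 ⟨hx, hxB⟩
    have hrep := green_representation (by norm_num : 0 < 2) (A \ B) F hx'
    have hsum0 : ∑ w ∈ A \ B, dirichletGreen (A \ B) x w * -latticeLaplacianZd F w = 0 := by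
      refine Finset.sum_eq_zero fun w hw => ?_
      obtain ⟨hwA, hwB⟩ := Finset.mem_sdiff.1 hw
      have hwy : w ≠ y := fun h => hwB (h ▸ hy)
      rw [hF, latticeLaplacianZd_killedGreen_eq_zero_of_ne A hyA hwA hwy, neg_zero, mul_zero]
    rw [hsum0, zero_add] at hrep
    -- both sums reduce to the sum over `T = ∂(A ∖ B) ∩ B`
    set T : Finset (Site 2) := outerBoundary (zdGraph 2) (A \ B) ∩ B with hT
    have h1 : ∑ z ∈ outerBoundary (zdGraph 2) (A \ B), poissonKernel (A \ B) x z * F z =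
        ∑ z ∈ T, poissonKernel (A \ B) x z * F z := by
      symm
      refine Finset.sum_subset Finset.inter_subset_left fun z hz hzT => ?_
      have hzB : z ∉ B := fun hzB => hzT (Finset.mem_inter.2 ⟨hz, hzB⟩)
      have hzA : z ∉ A := fun hzA => (mem_outerBoundary_iff.1 hz).1 (Finset.mem_sdiff.2 ⟨hzA, hzB⟩)
      rw [hF]
      simp only
      rw [killedGreen_siteGraph_of_not_mem A hzA hyA, mul_zero]
    have h2 : ∑ b ∈ B, poissonKernel (A \ B) x b * F b = ∑ z ∈ T, poissonKernel (A \ B) x z * F z := by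
      symm
      refine Finset.sum_subset Finset.inter_subset_right fun b hb hbT => ?_
      have hbS : b ∉ outerBoundary (zdGraph 2) (A \ B) := fun h => hbT (Finset.mem_inter.2 ⟨h, hb⟩)
      rw [poissonKernel_of_not_mem_outerBoundary (A \ B) x hbS, zero_mul]
    rw [h1] at hrep
    have key : F x = ∑ b ∈ B, poissonKernel (A \ B) x b * F b := by rw [hrep, ← h2]
    simpa only [hF] using key
  · rw [killedGreen_siteGraph_of_not_mem A hx hyA]
    symm
    refine Finset.sum_eq_zero fun b _ => ?_
    rw [poissonKernel_of_not_mem_left (A \ B) (fun h => hx (Finset.mem_sdiff.1 h).1), zero_mul]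

/-- The hitting distribution of `B` before leaving `A` has total mass at most one:
`P^x(τ_B < ξ_A) = Σ_{b ∈ B} H_{A∖B}(x,b) ≤ 1`. [folklore] -/
theorem sum_hitDist_le_one (B : Finset (Site 2)) (x : Site 2) :
    ∑ b ∈ B, poissonKernel (A \ B) x b ≤ 1 := by
  classical
  by_cases hx : x ∈ A \ B
  · have h1 : ∑ z ∈ outerBoundary (zdGraph 2) (A \ B), poissonKernel (A \ B) x z = 1 :=
      sum_poissonKernel (by norm_num) (A \ B) hx
    set T : Finset (Site 2) := outerBoundary (zdGraph 2) (A \ B) ∩ B with hT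
    have h2 : ∑ b ∈ B, poissonKernel (A \ B) x b = ∑ z ∈ T, poissonKernel (A \ B) x z := by
      symm
      refine Finset.sum_subset Finset.inter_subset_right fun b hb hbT => ?_
      have hbS : b ∉ outerBoundary (zdGraph 2) (A \ B) := fun h => hbT (Finset.mem_inter.2 ⟨h, hb⟩)
      exact poissonKernel_of_not_mem_outerBoundary (A \ B) x hbS
    rw [h2, ← h1]
    exact Finset.sum_le_sum_of_subset_of_nonneg Finset.inter_subset_left
      fun z _ _ => poissonKernel_nonneg (by norm_num) (A \ B) x z
  · rw [Finset.sum_eq_zero fun b _ => poissonKernel_of_not_mem_left (A \ B) hx b]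
    exact zero_le_one

/-- **First-moment hitting bound** (Lawler 1991, (2.46)–(2.47)): if the expected number of visits to
`B` from every point of `B` is at most `M`, `Σ_{y ∈ B} G_A(b,y) ≤ M` for `b ∈ B`, then from any
`x ∉ B`, `Σ_{y ∈ B} G_A(x,y) ≤ M · P^x(τ_B < ξ_A)` with `P^x(τ_B < ξ_A) = Σ_{b ∈ B} H_{A∖B}(x,b)`;
in particular `P^x(τ_B < ξ_A) ≥ E^x[V]/max_b E^b[V]`. [cite: Lawler1991, §2.3 (2.46)–(2.47)] -/
theorem sum_killedGreen_le_mul_hitProb {B : Finset (Site 2)} (hBA : B ⊆ A) {x : Site 2} (hxB : x ∉ B)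
    {M : ℝ} (hM : ∀ b ∈ B, ∑ y ∈ B, SRW.killedGreen (ChordalLERW.siteGraph (↑A : Set (Site 2))) b y ≤ M) :
    ∑ y ∈ B, SRW.killedGreen (ChordalLERW.siteGraph (↑A : Set (Site 2))) x y ≤
      M * ∑ b ∈ B, poissonKernel (A \ B) x b := by
  have hH0 : ∀ b, 0 ≤ poissonKernel (A \ B) x b := fun b => poissonKernel_nonneg (by norm_num) (A \ B) x b
  calc ∑ y ∈ B, SRW.killedGreen (ChordalLERW.siteGraph (↑A : Set (Site 2))) x y
      = ∑ y ∈ B, ∑ b ∈ B, poissonKernel (A \ B) x b *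
          SRW.killedGreen (ChordalLERW.siteGraph (↑A : Set (Site 2))) b y :=
        Finset.sum_congr rfl fun y hy => killedGreen_eq_sum_hitDist_mul A hBA hy hxB
    _ = ∑ b ∈ B, poissonKernel (A \ B) x b *
          ∑ y ∈ B, SRW.killedGreen (ChordalLERW.siteGraph (↑A : Set (Site 2))) b y := by
        rw [Finset.sum_comm]
        exact Finset.sum_congr rfl fun b _ => (Finset.mul_sum _ _ _).symm
    _ ≤ ∑ b ∈ B, poissonKernel (A \ B) x b * M :=
        Finset.sum_le_sum fun b hb => mul_le_mul_of_nonneg_left (hM b hb) (hH0 b)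
    _ = M * ∑ b ∈ B, poissonKernel (A \ B) x b := by rw [← Finset.sum_mul, mul_comm]

end PlanarSet

end KozdronLawler

end Literature.Probability.LatticeModels

end
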